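/-
Copyright (c) 2026. All rights reserved.
Released under Apache 2.0 license as described in the file LICENSE.
Authors: abc-iut cell, wave-2 seat abc-iut-L3-t11 (proof-only; G10 rungs 3a/3b, step (2) of the printed
proof of [SemiAnbd] Thm 3.7 (iii)).
-/
import Literature.AnabelianGeometry.SemiGraphs.TreeFixedPairProofs
import HarnessLib

/-!
# Fixed branch-pairs: three fixed vertices of a tree, and descent along equivariant immersions

Mochizuki, *Semi-graphs of anabelioids*, Publ. RIMS **42** (2006) [MochizukiSemiAnbd2006], proof of
Theorem 3.7 (iii), p. 41 (PRIMS p. 266): "suppose that for some cofinal subset `J ⊆ I`, `H` fixes `≥ 3`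
vertices of `G_{∞,j}` … by Lemma 1.8 (ii)(c) … `H` acts trivially on some subjoint of `G_{∞,j}`. In
particular, `H` acts trivially on some subjoint of `G_j`. … `H` is contained … for two distinct branches
`b`, `b'` abutting to `v` of edges `e`, `e'` [where `e` is not necessarily distinct from `e'`], in the
intersection of the images … via `b`, `b'`" — so what descends to the FINITE level `G_j` and feeds total
estrangement is a *fixed branch-pair*: a vertex `v` with two DISTINCT branches `c₁ ≠ c₂` abutting to it, all
three fixed (downstairs the two edges may coincide — a loop).

This PROOF-ONLY file provides, over the landed Lemma 1.8 (ii)(b)(c) tool files: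

* `exists_fixed_branchPair_of_two_fixed_or_adjacent` / `exists_fixed_branchPair_of_three_fixed` — in a
  tree, two non-adjacent (resp. three distinct) fixed vertices yield a fixed branch-pair (with explicit
  `v, c₁, c₂`, not just an abstract subjoint);
* `fixed_branchPair_map` — a fixed branch-pair maps, along a morphism of semi-graphs intertwining the two
  actions that is an IMMERSION (injective on stars — e.g. a graph-covering), to a fixed branch-pair.

No definitions; nothing specific to anabelioids.
-/

namespace Literature.AnabelianGeometry.SemiGraphs

namespace SemiGraph

open CategoryTheory

universe u

variable {G G' : SemiGraph.{u}}

/-! ### Fixed branch-pairs in a tree -/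

/-- Two distinct fixed vertices of a tree: EITHER a fixed branch-pair `(v; c₁ ≠ c₂)` exists (at an interior
vertex of the geodesic, carrying its two geodesic edges), OR the two vertices are joined by a single closed
edge fixed with its branches (the dichotomy of `TreeFixedPairProofs` with the branch data made explicit).
[cite: MochizukiSemiAnbd2006, Thm 3.7(iii) p.41] -/
theorem exists_fixed_branchPair_of_two_fixed_or_adjacent {Γ : Type u} [Group Γ] (ρ : Γ →* Aut G)
    (hG : G.IsTree) {w₁ w₂ : G.Vertex} (hne : w₁ ≠ w₂) (hw₁ : ∀ γ, (ρ γ).hom.vertexMap w₁ = w₁)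
    (hw₂ : ∀ γ, (ρ γ).hom.vertexMap w₂ = w₂) :
    (∃ (v : G.Vertex) (c₁ c₂ : G.Branch), c₁ ≠ c₂ ∧ G.abuts c₁ = some v ∧ G.abuts c₂ = some v ∧
      ∀ γ, (ρ γ).hom.vertexMap v = v ∧ (ρ γ).hom.branchMap c₁ = c₁ ∧ (ρ γ).hom.branchMap c₂ = c₂) ∨
    (∃ (e : G.Edge) (c c' : G.Branch), c ≠ c' ∧ G.edgeOf c = e ∧ G.edgeOf c' = e ∧
      G.abuts c = some w₁ ∧ G.abuts c' = some w₂ ∧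
      ∀ γ, (ρ γ).hom.edgeMap e = e ∧ ∀ b : G.Branch, G.edgeOf b = e → (ρ γ).hom.branchMap b = b) := by
  have hA : G.subdivision.IsAcyclic := hG.isTree.isAcyclic
  have hC : G.subdivision.Connected := hG.isTree.connected
  obtain ⟨p, hp⟩ := hC.exists_isPath (Sum.inl w₁) (Sum.inl w₂)
  have fixV : ∀ z ∈ p.support, ∀ γ, nodeMap (ρ γ) z = z := fun z hz γ =>
    nodeMap_eq_self_of_isPath hA (ρ γ) (by simp [hw₁ γ]) (by simp [hw₂ γ]) p hp z hz
  rcases path_between_vertices_shape hne p hp with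
    ⟨v, e₁, e₂, c₁, c₂, hee, hc₁e, hc₁v, hc₂e, hc₂v, hvs, he₁s, he₂s⟩ | ⟨e, c, c', hcc, hce, hc'e, hcw₁, hc'w₂, hes⟩
  · left
    have hv : ∀ γ, (ρ γ).hom.vertexMap v = v := fun γ => by simpa using fixV _ hvs γ
    have he₁ : ∀ γ, (ρ γ).hom.edgeMap e₁ = e₁ := fun γ => by simpa using fixV _ he₁s γ
    have he₂ : ∀ γ, (ρ γ).hom.edgeMap e₂ = e₂ := fun γ => by simpa using fixV _ he₂s γ
    refine ⟨v, c₁, c₂, fun h => hee (by rw [← hc₁e, ← hc₂e, h]), hc₁v, hc₂v, fun γ => ⟨hv γ, ?_, ?_⟩⟩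
    · exact branchMap_eq_self_of_fixed hA (ρ γ) hc₁e hc₁v (hv γ) (he₁ γ) c₁ hc₁e
    · exact branchMap_eq_self_of_fixed hA (ρ γ) hc₂e hc₂v (hv γ) (he₂ γ) c₂ hc₂e
  · right
    have hefix : ∀ γ, (ρ γ).hom.edgeMap e = e := fun γ => by simpa using fixV _ hes γ
    exact ⟨e, c, c', hcc, hce, hc'e, hcw₁, hc'w₂, fun γ =>
      ⟨hefix γ, fun b hbe => branchMap_eq_self_of_fixed hA (ρ γ) hce hcw₁ (hw₁ γ) (hefix γ) b hbe⟩⟩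

/-- **Three distinct fixed vertices of a tree yield a fixed branch-pair** (Lemma 1.8 (ii)(c) with explicit
data): some vertex `v` carries two distinct branches `c₁ ≠ c₂`, and `v`, `c₁`, `c₂` are fixed by the group.
[cite: MochizukiSemiAnbd2006, Thm 3.7(iii) p.41] -/
theorem exists_fixed_branchPair_of_three_fixed {Γ : Type u} [Group Γ] (ρ : Γ →* Aut G) (hG : G.IsTree)
    {w₁ w₂ w₃ : G.Vertex} (h₁₂ : w₁ ≠ w₂) (h₂₃ : w₂ ≠ w₃) (h₁₃ : w₁ ≠ w₃)
    (hw₁ : ∀ γ, (ρ γ).hom.vertexMap w₁ = w₁) (hw₂ : ∀ γ, (ρ γ).hom.vertexMap w₂ = w₂)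
    (hw₃ : ∀ γ, (ρ γ).hom.vertexMap w₃ = w₃) :
    ∃ (v : G.Vertex) (c₁ c₂ : G.Branch), c₁ ≠ c₂ ∧ G.abuts c₁ = some v ∧ G.abuts c₂ = some v ∧
      ∀ γ, (ρ γ).hom.vertexMap v = v ∧ (ρ γ).hom.branchMap c₁ = c₁ ∧ (ρ γ).hom.branchMap c₂ = c₂ := by
  have hA : G.subdivision.IsAcyclic := hG.isTree.isAcyclic
  rcases exists_fixed_branchPair_of_two_fixed_or_adjacent ρ hG h₁₂ hw₁ hw₂ with h | ⟨e, c, c', hcc, hce, hc'e, hcw₁, hc'w₂, hfix⟩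
  · exact h
  rcases exists_fixed_branchPair_of_two_fixed_or_adjacent ρ hG h₂₃ hw₂ hw₃ with h | ⟨f, d, d', hdd, hdf, hd'f, hdw₂, hd'w₃, hfix'⟩
  · exact h
  -- `w₁ –e– w₂ –f– w₃`: the branches `c'` (of `e`) and `d` (of `f`) at `w₂` are distinct
  have hc'd : c' ≠ d := by
    intro h
    -- then `e = f`, and `e` would abut to `w₁`, `w₂`, `w₃` via its two branches
    have hef : e = f := by rw [← hc'e, h, hdf]
    subst hef
    have hd'c : d' = c :=
      branch_eq_of_ne_of_ne hc'e hd'f hce (by rw [h]; exact fun h' => hdd h'.symm) hcc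
    have : some w₃ = some w₁ := by rw [← hd'w₃, hd'c, hcw₁]
    exact h₁₃ (by simpa using this.symm)
  exact ⟨w₂, c', d, hc'd, hc'w₂, hdw₂, fun γ =>
    ⟨hw₂ γ, (hfix γ).2 c' hc'e, (hfix' γ).2 d hdf⟩⟩

/-! ### Descent of fixed branch-pairs along equivariant immersions -/

/-- **A fixed branch-pair descends along an equivariant immersion** (p. 41: "in particular, `H` acts
trivially on some subjoint of `G_j`"; downstairs the two edges may coincide): if `φ : G ⟶ G'` intertwines
actions `ρ`, `ρ'` of `Γ` and is injective on the branches at every vertex (an immersion — e.g. a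
graph-covering), then a branch-pair `(v; c₁ ≠ c₂)` fixed by `ρ` maps to the branch-pair
`(φ v; φ c₁ ≠ φ c₂)` fixed by `ρ'`. [cite: MochizukiSemiAnbd2006, Thm 3.7(iii) p.41] -/
theorem fixed_branchPair_map {Γ : Type u} [Group Γ] (ρ : Γ →* Aut G) (ρ' : Γ →* Aut G')
    (φ : G ⟶ G') (himm : IsImmersion φ) (hequiv : ∀ γ, (ρ γ).hom ≫ φ = φ ≫ (ρ' γ).hom)
    {v : G.Vertex} {c₁ c₂ : G.Branch} (hne : c₁ ≠ c₂) (hc₁ : G.abuts c₁ = some v)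
    (hc₂ : G.abuts c₂ = some v)
    (hfix : ∀ γ, (ρ γ).hom.vertexMap v = v ∧ (ρ γ).hom.branchMap c₁ = c₁ ∧ (ρ γ).hom.branchMap c₂ = c₂) :
    φ.branchMap c₁ ≠ φ.branchMap c₂ ∧ G'.abuts (φ.branchMap c₁) = some (φ.vertexMap v) ∧
      G'.abuts (φ.branchMap c₂) = some (φ.vertexMap v) ∧
      ∀ γ, (ρ' γ).hom.vertexMap (φ.vertexMap v) = φ.vertexMap v ∧
        (ρ' γ).hom.branchMap (φ.branchMap c₁) = φ.branchMap c₁ ∧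
        (ρ' γ).hom.branchMap (φ.branchMap c₂) = φ.branchMap c₂ := by
  refine ⟨fun h => hne ?_, φ.abuts_branchMap c₁ v hc₁, φ.abuts_branchMap c₂ v hc₂, fun γ => ?_⟩
  · have := himm v (a₁ := ⟨c₁, hc₁⟩) (a₂ := ⟨c₂, hc₂⟩) (Subtype.ext h)
    exact congrArg Subtype.val this
  · obtain ⟨hv, h₁, h₂⟩ := hfix γ
    have hV := congrArg (fun ψ : G ⟶ G' => ψ.vertexMap v) (hequiv γ)
    have hB₁ := congrArg (fun ψ : G ⟶ G' => ψ.branchMap c₁) (hequiv γ)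
    have hB₂ := congrArg (fun ψ : G ⟶ G' => ψ.branchMap c₂) (hequiv γ)
    simp only [comp_vertexMap, comp_branchMap, Function.comp_apply, hv, h₁, h₂] at hV hB₁ hB₂
    exact ⟨hV.symm, hB₁.symm, hB₂.symm⟩

/-- Combining the two: three distinct fixed vertices upstairs give a fixed branch-pair downstairs.
[cite: MochizukiSemiAnbd2006, Thm 3.7(iii) p.41] -/
theorem exists_fixed_branchPair_map_of_three_fixed {Γ : Type u} [Group Γ] (ρ : Γ →* Aut G)
    (ρ' : Γ →* Aut G') (φ : G ⟶ G') (himm : IsImmersion φ)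
    (hequiv : ∀ γ, (ρ γ).hom ≫ φ = φ ≫ (ρ' γ).hom) (hG : G.IsTree)
    {w₁ w₂ w₃ : G.Vertex} (h₁₂ : w₁ ≠ w₂) (h₂₃ : w₂ ≠ w₃) (h₁₃ : w₁ ≠ w₃)
    (hw₁ : ∀ γ, (ρ γ).hom.vertexMap w₁ = w₁) (hw₂ : ∀ γ, (ρ γ).hom.vertexMap w₂ = w₂)
    (hw₃ : ∀ γ, (ρ γ).hom.vertexMap w₃ = w₃) :
    ∃ (v' : G'.Vertex) (d₁ d₂ : G'.Branch), d₁ ≠ d₂ ∧ G'.abuts d₁ = some v' ∧ G'.abuts d₂ = some v' ∧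
      ∀ γ, (ρ' γ).hom.vertexMap v' = v' ∧ (ρ' γ).hom.branchMap d₁ = d₁ ∧ (ρ' γ).hom.branchMap d₂ = d₂ := by
  obtain ⟨v, c₁, c₂, hne, hc₁, hc₂, hfix⟩ :=
    exists_fixed_branchPair_of_three_fixed ρ hG h₁₂ h₂₃ h₁₃ hw₁ hw₂ hw₃
  obtain ⟨hne', hd₁, hd₂, hfix'⟩ := fixed_branchPair_map ρ ρ' φ himm hequiv hne hc₁ hc₂ hfix
  exact ⟨φ.vertexMap v, φ.branchMap c₁, φ.branchMap c₂, hne', hd₁, hd₂, hfix'⟩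

end SemiGraph

end Literature.AnabelianGeometry.SemiGraphs
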